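import Literature.Computability.Cryptography.WordRAMInline1
import HarnessLib

/-!
# The word RAM — inline simulation of oracle calls, II: the query block

The block of the simulating machine `M'` that emulates one `query qa ql aa` instruction of the
reduction `M` (V. Vassilevska Williams, ICM 2018, §2, the remark after Def. 2.1: "replacing the
oracle calls by the corresponding runs of the algorithm"): read the three operands
(`Q0`), compute the word size `2 ^ (k_B · inputWidth q)` of the query segment `q` (the width
routine of `…WordRAMWidth`), bump the generation of the stamped scratch memory (so the emulated
memory of `M_B` is instantly all-zero), copy `q` into it (`cinBody`), run the compiled `M_B`
(`…WordRAMEmulator`), copy the answer length and the answer words (reduced modulo `2 ^ ws`)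
back into the emulated memory of `M` (`Q5`, `coutBody`) — exactly the effect of `WordRAM.step`
on a `query` with the oracle "output of `M_B`". Main result: `run_QB`.

## References

* V. Vassilevska Williams, *On some fine-grained questions in algorithms and complexity*,
  Proc. ICM 2018, §2 (Def. 2.1 and the remark following it).
-/

namespace Literature.Computability.Cryptography.WordRAM

open StateTransition


namespace Inline

/-! ## Side invariants and frames -/

section frames

variable {W : ℕ}

/-- The `M`-side of the simulation state: target invariant of the `M`-emulation and agreement of
the emulated `M`-memory with `dmem`. [folklore] -/
def MSide (W ws VT : ℕ) (dmem mem : ℕ → ℕ) : Prop :=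
  TInv LM (EM W ws) VT mem ∧ Agree (EM W ws) mem dmem

/-- The `B`-side: target invariant of the `M_B`-emulation (generation `g`) and agreement of the
emulated `M_B`-memory with `dmemB`. [folklore] -/
def BSide (W g wsB VT : ℕ) (dmemB mem : ℕ → ℕ) : Prop :=
  TInv LB (EB W g wsB) VT mem ∧ Agree (EB W g wsB) mem dmemB

/-- The `M`-side only depends on registers `4 … 7` and the cells `[40, 2Q)` (plus the global
value bound). [folklore] -/
theorem MSide.of_frame {ws VT : ℕ} {dmem mem mem' : ℕ → ℕ} (hW : 8 ≤ W) (h : MSide W ws VT dmem mem)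
    (hT : MemLE VT mem')
    (hf : ∀ c, (c = 4 ∨ c = 5 ∨ c = 6 ∨ c = 7 ∨ (40 ≤ c ∧ c < 2 * Qv W)) → mem' c = mem c) :
    MSide W ws VT dmem mem' := by
  have hQ := Qv_ge hW
  obtain ⟨⟨⟨e4, e5, e6, e7⟩, hst, -⟩, hag⟩ := h
  refine ⟨⟨⟨?_, ?_, ?_, ?_⟩, fun a ha => ?_, hT⟩, fun a ha => ?_⟩
  · rw [LM_rB] at e4 ⊢; rw [hf 4 (by simp), e4]
  · rw [LM_rS] at e5 ⊢; rw [hf 5 (by simp), e5]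
  · rw [LM_rGen] at e6 ⊢; rw [hf 6 (by simp), e6]
  · rw [LM_rP] at e7 ⊢; rw [hf 7 (by simp), e7]
  · simp only [EM_Q] at ha; simp only [EM_Sv, EM_Gv] at hst ⊢
    rw [hf _ (by omega)]; exact hst a (by simpa using ha)
  · simp only [EM_Q] at ha
    rw [← hag a (by simpa using ha)]
    exact edec_congr (hf _ (by simp only [EM_Sv]; omega)) (hf _ (by simp only [EM_Bv]; omega))

/-- The `B`-side only depends on registers `8 … 11` and the cells `[2Q, 4Q)`. [folklore] -/
theorem BSide.of_frame {g wsB VT : ℕ} {dmemB mem mem' : ℕ → ℕ} (hW : 8 ≤ W)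
    (h : BSide W g wsB VT dmemB mem) (hT : MemLE VT mem')
    (hf : ∀ c, (c = 8 ∨ c = 9 ∨ c = 10 ∨ c = 11 ∨ (2 * Qv W ≤ c ∧ c < 4 * Qv W)) → mem' c = mem c) :
    BSide W g wsB VT dmemB mem' := by
  have hQ := Qv_ge hW
  obtain ⟨⟨⟨e4, e5, e6, e7⟩, hst, -⟩, hag⟩ := h
  refine ⟨⟨⟨?_, ?_, ?_, ?_⟩, fun a ha => ?_, hT⟩, fun a ha => ?_⟩
  · rw [LB_rB] at e4 ⊢; rw [hf 8 (by simp), e4]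
  · rw [LB_rS] at e5 ⊢; rw [hf 9 (by simp), e5]
  · rw [LB_rGen] at e6 ⊢; rw [hf 10 (by simp), e6]
  · rw [LB_rP] at e7 ⊢; rw [hf 11 (by simp), e7]
  · simp only [EB_Q] at ha; simp only [EB_Sv, EB_Gv] at hst ⊢
    rw [hf _ (by omega)]; exact hst a (by simpa using ha)
  · simp only [EB_Q] at ha
    rw [← hag a (by simpa using ha)]
    exact edec_congr (hf _ (by simp only [EB_Sv]; omega)) (hf _ (by simp only [EB_Bv]; omega))

/-- The `B`-side *between* oracle calls: the two base registers hold `2Q` and `3Q` and every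
`B`-stamp is at most `g` (no modulus, no agreement — the next query block bumps the generation
and installs its own word size). [folklore] -/
def BPre (W g : ℕ) (mem : ℕ → ℕ) : Prop :=
  mem 8 = 2 * Qv W ∧ mem 9 = 3 * Qv W ∧ ∀ a, a < Qv W → mem (3 * Qv W + a) ≤ g

/-- A `B`-side is in particular a `B`-side between calls. [folklore] -/
theorem BSide.bpre {g wsB VT : ℕ} {dmemB mem : ℕ → ℕ} (h : BSide W g wsB VT dmemB mem) :
    BPre W g mem := by
  obtain ⟨⟨⟨e4, e5, -, -⟩, hst, -⟩, -⟩ := h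
  simp only [LB_rB, LB_rS, EB_Bv, EB_Sv] at e4 e5
  exact ⟨e4, e5, fun a ha => by simpa [EB_Sv, EB_Gv] using hst a (by simpa [EB_Q] using ha)⟩

/-- `BPre` is preserved by any memory change outside registers `8`–`11` and the `B`-regions
`[2Q, 4Q)` (the frame in which the query-block phases are stated; `BPre` itself only reads
registers `8, 9` and the stamp cells `[3Q, 4Q)`). [folklore] -/
theorem BPre.of_frame {g : ℕ} {mem mem' : ℕ → ℕ} (h : BPre W g mem)
    (hf : ∀ c, (c = 8 ∨ c = 9 ∨ c = 10 ∨ c = 11 ∨ (2 * Qv W ≤ c ∧ c < 4 * Qv W)) → mem' c = mem c) :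
    BPre W g mem' := by
  obtain ⟨e4, e5, hst⟩ := h
  refine ⟨by rw [hf 8 (by simp), e4], by rw [hf 9 (by simp), e5], fun a ha => ?_⟩
  rw [hf _ (by omega)]; exact hst a ha

/-- Bumping the generation: with the generation register rewritten to `g'` above all stamps, the
`B`-side holds for generation `g'` with the all-zero emulated memory. [folklore] -/
theorem BPre.bump {g g' wsB' VT : ℕ} {mem : ℕ → ℕ} (h : BPre W g mem)
    (hgg : g < g') {mem' : ℕ → ℕ} (hT : MemLE VT mem') (h10 : mem' 10 = g') (h11 : mem' 11 = 2 ^ wsB')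
    (hf : ∀ c, (c = 8 ∨ c = 9 ∨ (2 * Qv W ≤ c ∧ c < 4 * Qv W)) → mem' c = mem c) :
    BSide W g' wsB' VT (fun _ => 0) mem' := by
  obtain ⟨e4, e5, hst⟩ := h
  have hst' : ∀ a, a < Qv W → mem' (3 * Qv W + a) < g' := fun a ha => by
    rw [hf _ (by omega)]; exact lt_of_le_of_lt (hst a ha) hgg
  refine ⟨⟨⟨?_, ?_, ?_, ?_⟩, fun a ha => ?_, hT⟩, fun a ha => ?_⟩
  · rw [LB_rB, EB_Bv, hf 8 (by simp), e4]
  · rw [LB_rS, EB_Sv, hf 9 (by simp), e5]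
  · rw [LB_rGen, EB_Gv, h10]
  · rw [LB_rP, EB_ws, h11]
  · simp only [EB_Q] at ha; simp only [EB_Sv, EB_Gv]; exact (hst' a ha).le
  · simp only [EB_Q] at ha
    simp only [edec, EB_Sv, EB_Gv, EB_Bv]
    rw [if_neg (hst' a ha).ne]

end frames

/-! ## The query block: code -/

/-- A no-op (writes to an immediate operand). [folklore] -/
def nopOp : OpSpec := (.add, .imm 0, .imm 0, .imm 0)

/-- `nopOp` leaves the memory unchanged. [folklore] -/
@[simp] theorem execOp_nopOp (W : ℕ) (mem : ℕ → ℕ) : execOp W mem nopOp = mem := rfl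

/-- Padding no-ops change nothing. [folklore] -/
theorem execOps_replicate_nopOp (W : ℕ) (mem : ℕ → ℕ) (n : ℕ) :
    execOps W mem (List.replicate n nopOp) = mem := by
  induction n generalizing mem with
  | zero => rfl
  | succ n ih => rw [List.replicate_succ, execOps_cons, execOp_nopOp, ih]

/-- Emulated operand read into register `T`, padded with no-ops to length `12`. [folklore] -/
def erdPad (x : Operand) (T : ℕ) : List OpSpec :=
  erd LM x T ++ List.replicate (12 - (erd LM x T).length) nopOp

/-- Length of `erdPad` (always `12`). [folklore] -/
@[simp] theorem erdPad_length (x : Operand) (T : ℕ) : (erdPad x T).length = 12 := by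
  have := length_erd_le LM x T
  simp only [erdPad, List.length_append, List.length_replicate]; omega

/-- A padded emulated read has the semantics of the read. [folklore] -/
theorem execOps_erdPad (W : ℕ) (mem : ℕ → ℕ) (x : Operand) (T : ℕ) :
    execOps W mem (erdPad x T) = execOps W mem (erd LM x T) := by
  rw [erdPad, execOps_append, execOps_replicate_nopOp]

/-- Phase 0: read the three operands of the query into registers `15, 16, 17`. [folklore] -/
def Q0 (qa ql aa : Operand) : List OpSpec :=
  erdPad qa 15 ++ erdPad ql 16 ++ erdPad aa 17

/-- Phase 1: `R31 := R15 + 40` (target address of the query segment). [folklore] -/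
def Q1 : List OpSpec := [(.add, .dir 31, .dir 15, .imm 40)]

/-- Phase 2: `R11 := R30` (modulus of `M_B`), `R10 += 1` (new generation), `R12 := R16 % R11`,
and write it to `B`-cell `0` (the input length of `M_B`). [folklore] -/
def Q2 : List OpSpec :=
  [(.div, .dir 11, .dir 30, .imm 1), (.add, .dir 10, .dir 10, .imm 1), (.mod, .dir 12, .dir 16, .dir 11)] ++
    ewrAt LB (.imm 0) 12

/-- Phase 3: `R19 := R15 + 40; R20 := R16; R32 := 1` (copy-in loop arguments). [folklore] -/
def Q3 : List OpSpec :=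
  [(.add, .dir 19, .dir 15, .imm 40), (.div, .dir 20, .dir 16, .imm 1), (.div, .dir 32, .imm 1, .imm 1)]

/-- Copy-in round: `R12 := mem[R19] % R11`; write `R12` to `B`-cell `R32`; `R32 += 1; R19 += 1;
R20 -= 1`. [folklore] -/
def cinBody : List OpSpec :=
  [(.div, .dir 12, .ind 19, .imm 1), (.mod, .dir 12, .dir 12, .dir 11)] ++ ewrAt LB (.dir 32) 12 ++
    [(.add, .dir 32, .dir 32, .imm 1), (.add, .dir 19, .dir 19, .imm 1), (.sub, .dir 20, .dir 20, .imm 1)]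

/-- Phase 5: `R34 :=` `B`-cell `0` (the answer length); write it to `M`-cell `R17`;
`R33 := R17 + 1; R32 := 1; R20 := R34` (copy-out loop arguments). [folklore] -/
def Q5 : List OpSpec :=
  erdAt LB (.imm 0) 34 ++ ewrAt LM (.dir 17) 34 ++
    [(.add, .dir 33, .dir 17, .imm 1), (.div, .dir 32, .imm 1, .imm 1), (.div, .dir 20, .dir 34, .imm 1)]

/-- Copy-out round: `R12 :=` `B`-cell `R32`; `R12 %= R7`; write `R12` to `M`-cell `R33`;
`R32 += 1; R33 += 1; R20 -= 1`. [folklore] -/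
def coutBody : List OpSpec :=
  erdAt LB (.dir 32) 12 ++ [(.mod, .dir 12, .dir 12, .dir 7)] ++ ewrAt LM (.dir 33) 12 ++
    [(.add, .dir 32, .dir 32, .imm 1), (.add, .dir 33, .dir 33, .imm 1), (.sub, .dir 20, .dir 20, .imm 1)]

/-- The (empty) query blocks of the oracle-free `M_B`. [folklore] -/
def qb0 : ℕ → Operand → Operand → Operand → List Instr := fun _ _ _ _ => []

/-- The length of the compiled `M_B` (independent of its position). [folklore] -/
def ℓB (MB : Program) : ℕ := (compile LB 0 MB 0 qb0).length

/-- **The query block** at position `pos` for the source instruction `query qa ql aa`. [folklore] -/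
def QB (MB : Program) (kB pos : ℕ) (qa ql aa : Operand) : List Instr :=
  (Q0 qa ql aa).map OpSpec.toInstr ++ Q1.map OpSpec.toInstr ++ widthCode (pos + 37) kB ++
    Q2.map OpSpec.toInstr ++ Q3.map OpSpec.toInstr ++ loopBlock (pos + 88) 20 cinBody ++
    compile LB 0 MB (pos + 99) qb0 ++ Q5.map OpSpec.toInstr ++
    loopBlock (pos + 112 + ℓB MB) 20 coutBody

/-- The length of the query block. [folklore] -/
def qlenM (MB : Program) : ℕ := 128 + ℓB MB

/-- Length of `Q0`. [folklore] -/
@[simp] theorem Q0_length (qa ql aa : Operand) : (Q0 qa ql aa).length = 36 := by simp [Q0]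
/-- Length of `Q1`. [folklore] -/
@[simp] theorem Q1_length : Q1.length = 1 := rfl
/-- Length of `Q2`. [folklore] -/
@[simp] theorem Q2_length : Q2.length = 7 := rfl
/-- Length of `Q3`. [folklore] -/
@[simp] theorem Q3_length : Q3.length = 3 := rfl
/-- Length of `cinBody`. [folklore] -/
@[simp] theorem cinBody_length : cinBody.length = 9 := rfl
/-- Length of `Q5`. [folklore] -/
@[simp] theorem Q5_length : Q5.length = 13 := rfl
/-- Length of `coutBody`. [folklore] -/
@[simp] theorem coutBody_length : coutBody.length = 14 := rfl

/-- The length of the compiled `B`-program. [folklore] -/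
theorem length_compile_B (MB : Program) (base : ℕ) : (compile LB 0 MB base qb0).length = ℓB MB := by
  have h1 := length_compile (L := LB) (qlen := 0) (M := MB) (base := base) (qb := qb0) (fun _ _ _ _ => rfl)
  have h2 := length_compile (L := LB) (qlen := 0) (M := MB) (base := 0) (qb := qb0) (fun _ _ _ _ => rfl)
  simp only [exitPos, bstart, Nat.min_self, ℓB] at h1 h2 ⊢
  omega

/-- The exit position of the compiled `B`-program. [folklore] -/
theorem exitPos_B (MB : Program) (base : ℕ) : exitPos LB 0 MB base = base + ℓB MB := by
  have h1 := length_compile (L := LB) (qlen := 0) (M := MB) (base := base) (qb := qb0) (fun _ _ _ _ => rfl)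
  rw [length_compile_B] at h1; omega

/-- Length of the query block `QB` (`= qlenM MB`). [folklore] -/
@[simp] theorem QB_length (MB : Program) (kB pos : ℕ) (qa ql aa : Operand) :
    (QB MB kB pos qa ql aa).length = qlenM MB := by
  simp [QB, qlenM, length_compile_B]; omega

/-! ## The query block: phases 0–3 -/

section phases

variable {W ws VT V : ℕ}

/-- Phase 0 reads the three operands (values of the `V`-bounded source memory `dmem`) into
registers `15, 16, 17`, keeping the `M`-side and changing only registers `14`–`17`. [folklore] -/
theorem execOps_Q0 (hws : ws ≤ W) (hVT : VT + 1 = 2 ^ W) {mem dmem : ℕ → ℕ}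
    (hM : MSide W ws VT dmem mem) (hdm : MemLE V dmem) (hVQ : V < Qv W - 40) (hVVT : V ≤ VT)
    (qa ql aa : Operand) (hqa : qa.const ≤ V) (hql : ql.const ≤ V) (haa : aa.const ≤ V) :
    MSide W ws VT dmem (execOps W mem (Q0 qa ql aa)) ∧
      (execOps W mem (Q0 qa ql aa)) 15 = qa.read dmem ∧
      (execOps W mem (Q0 qa ql aa)) 16 = ql.read dmem ∧
      (execOps W mem (Q0 qa ql aa)) 17 = aa.read dmem ∧
      ∀ c, c ≠ 14 → c ≠ 15 → c ≠ 16 → c ≠ 17 → (execOps W mem (Q0 qa ql aa)) c = mem c := by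
  have hW : 8 ≤ W := eight_le_of_Qv (by omega)
  have hOK := envOK_M hW hws
  have hQ := Qv_ge hW
  have h255 : 255 ≤ VT := by
    have : 2 ^ 8 ≤ 2 ^ W := Nat.pow_le_pow_right (by norm_num) hW
    omega
  have hVQ' : V < (EM W ws).Q := by simpa using hVQ
  obtain ⟨hI, hag⟩ := hM
  rw [Q0, execOps_append, execOps_append, execOps_erdPad, execOps_erdPad, execOps_erdPad]
  obtain ⟨hI₁, hv₁, hag₁, hf₁⟩ := execOps_erd hOK hVT hI hag hdm hVQ' hVVT (by omega) qa hqa (T := 15)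
    (by simp) (by simp) (by simp only [EM_Bv, EM_Sv]; omega) (by omega)
  obtain ⟨hI₂, hv₂, hag₂, hf₂⟩ := execOps_erd hOK hVT hI₁ hag₁ hdm hVQ' hVVT (by omega) ql hql (T := 16)
    (by simp) (by simp) (by simp only [EM_Bv, EM_Sv]; omega) (by omega)
  obtain ⟨hI₃, hv₃, hag₃, hf₃⟩ := execOps_erd hOK hVT hI₂ hag₂ hdm hVQ' hVVT (by omega) aa haa (T := 17)
    (by simp) (by simp) (by simp only [EM_Bv, EM_Sv]; omega) (by omega)
  simp only [LM_ta] at hf₁ hf₂ hf₃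
  refine ⟨⟨hI₃, hag₃⟩, ?_, ?_, hv₃, fun c h14 h15 h16 h17 => ?_⟩
  · rw [hf₃ _ (by decide) (by decide), hf₂ _ (by decide) (by decide), hv₁]
  · rw [hf₃ _ (by decide) (by decide), hv₂]
  · rw [hf₃ _ h17 h14, hf₂ _ h16 h14, hf₁ _ h15 h14]

/-- Semantics of query-block phase `Q1`. [folklore] -/
theorem execOps_Q1 (mem : ℕ → ℕ) (h15 : mem 15 + 40 < 2 ^ W) :
    (execOps W mem Q1) 31 = 40 + mem 15 ∧ ∀ c, c ≠ 31 → (execOps W mem Q1) c = mem c := by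
  simp only [Q1, execOps_cons, execOps_nil, execOp_dir, Operand.read_dir, Operand.read_imm,
    BinOp.eval, Function.update_self, Nat.mod_eq_of_lt h15]
  exact ⟨Nat.add_comm _ _, fun c hc => Function.update_of_ne hc _ _⟩

/-- Phase 2: with `2 ^ wsB` in register `30`, `L` in register `16`, generation `g` in register
`10` above all `B`-stamps: afterwards registers `10, 11` hold `g + 1, 2 ^ wsB`, and the `B`-side
holds for generation `g + 1`, word size `wsB` and the emulated memory `0 ↦ L % 2 ^ wsB`, all other
cells `0`; the `M`-side is kept; only registers `10, 11, 12, 14` and `B`-region cells change. [folklore] -/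
theorem execOps_Q2 (hW : 8 ≤ W) (hVT : VT + 1 = 2 ^ W) {mem dmem : ℕ → ℕ} {g g₀ wsB L : ℕ}
    (hM : MSide W ws VT dmem mem) (hB : BPre W g₀ mem) (hg : g₀ ≤ g) (h10 : mem 10 = g)
    (h30 : mem 30 = 2 ^ wsB) (h16 : mem 16 = L) (hwsB : wsB < W) (hgT : g + 1 ≤ VT) :
    MSide W ws VT dmem (execOps W mem Q2) ∧
      BSide W (g + 1) wsB VT (Function.update (fun _ => 0) 0 (L % 2 ^ wsB)) (execOps W mem Q2) ∧
      (execOps W mem Q2) 10 = g + 1 ∧ (execOps W mem Q2) 11 = 2 ^ wsB ∧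
      ∀ c, c ≠ 10 → c ≠ 11 → c ≠ 12 → c ≠ 14 → ¬ (2 * Qv W ≤ c ∧ c < 4 * Qv W) →
        (execOps W mem Q2) c = mem c := by
  have hOKB := envOK_B (g := g + 1) hW hwsB.le
  have hQ := Qv_ge hW
  have h4Q := four_mul_Qv (show 2 ≤ W by omega)
  have h255 : 255 ≤ VT := by
    have : 2 ^ 8 ≤ 2 ^ W := Nat.pow_le_pow_right (by norm_num) hW
    omega
  have hgW : g + 1 < 2 ^ W := by omega
  have hP : 2 ^ wsB ≤ VT := by
    have := Nat.pow_lt_pow_right (show 1 < 2 by norm_num) hwsB; omega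
  rw [Q2, execOps_append]
  set m₁ := execOps W mem [(.div, .dir 11, .dir 30, .imm 1), (.add, .dir 10, .dir 10, .imm 1),
    (.mod, .dir 12, .dir 16, .dir 11)] with hm₁
  have hm₁v : m₁ = Function.update (Function.update (Function.update mem 11 (2 ^ wsB)) 10 (g + 1)) 12
      (L % 2 ^ wsB) := by
    simp only [hm₁, execOps_cons, execOps_nil, execOp_dir, Operand.read_dir, Operand.read_imm,
      BinOp.eval, Nat.div_one, h30]
    simp (config := { decide := true }) only [Function.update_self, Function.update_of_ne, ne_eq,
      h10, h16, Nat.mod_eq_of_lt hgW]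
  have hf₁ : ∀ c, c ≠ 10 → c ≠ 11 → c ≠ 12 → m₁ c = mem c := fun c h10' h11' h12' => by
    rw [hm₁v]; simp only [Function.update_of_ne h12', Function.update_of_ne h10', Function.update_of_ne h11']
  have hT₁ : MemLE VT m₁ := by
    intro c; rw [hm₁v]; simp only [Function.update_apply]
    split_ifs
    · exact le_trans (Nat.mod_lt _ (Nat.two_pow_pos _)).le hP
    · exact hgT
    · exact hP
    · exact hM.1.memT c
  have hM₁ : MSide W ws VT dmem m₁ :=
    hM.of_frame hW hT₁ fun c hc => hf₁ c (by omega) (by omega) (by omega)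
  have hB₁ : BSide W (g + 1) wsB VT (fun _ => 0) m₁ :=
    hB.bump (by omega) hT₁ (by rw [hm₁v]; simp) (by rw [hm₁v]; simp)
      fun c hc => hf₁ c (by omega) (by omega) (by omega)
  have h12 : m₁ 12 = L % 2 ^ wsB := by rw [hm₁v]; simp
  obtain ⟨hIB, hagB, hf₂⟩ := execOps_ewrAt_agree hOKB hVT hB₁.1 hB₁.2 (dst := .imm 0) (Tv := 12)
    (operandStable_imm 0 _) (by simp) (by simp only [Operand.read_imm, EB_Q]; omega) (by simp)
    (by omega) (by omega)
  simp only [Operand.read_imm, LB_ta, EB_Bv, EB_Sv, Nat.add_zero, h12] at hagB hf₂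
  refine ⟨hM₁.of_frame hW hIB.memT fun c hc => hf₂ c (by omega) (by omega) (by omega), ⟨hIB, hagB⟩,
    by rw [hf₂ _ (by omega) (by omega) (by omega), hm₁v]; simp,
    by rw [hf₂ _ (by omega) (by omega) (by omega), hm₁v]; simp, fun c c10 c11 c12 c14 cB => ?_⟩
  rw [hf₂ c c14 (by omega) (by omega), hf₁ c c10 c11 c12]

/-- Semantics of query-block phase `Q3`. [folklore] -/
theorem execOps_Q3 (mem : ℕ → ℕ) (h15 : mem 15 + 40 < 2 ^ W) :
    (execOps W mem Q3) 19 = 40 + mem 15 ∧ (execOps W mem Q3) 20 = mem 16 ∧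
      (execOps W mem Q3) 32 = 1 ∧ ∀ c, c ≠ 19 → c ≠ 20 → c ≠ 32 → (execOps W mem Q3) c = mem c := by
  simp only [Q3, execOps_cons, execOps_nil, execOp_dir, Operand.read_dir, Operand.read_imm,
    BinOp.eval, Nat.div_one]
  simp (config := { decide := true }) only [Function.update_self, Function.update_of_ne, ne_eq,
    Nat.mod_eq_of_lt h15]
  refine ⟨Nat.add_comm _ _, trivial, trivial, fun c c19 c20 c32 => ?_⟩
  simp (config := { decide := true }) only [Function.update_of_ne, ne_eq, c19, c20, c32, not_false_eq_true]

/-! ## The copy-in loop -/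

/-- The emulated `M_B`-memory after `j` copy-in rounds: cell `0` holds `L % 2 ^ wsB`, cells
`1 … j` hold the first `j` words of the query segment (at source address `a`) reduced. [folklore] -/
def dmB (dmem : ℕ → ℕ) (wsB L a j : ℕ) : ℕ → ℕ := fun b =>
  if b = 0 then L % 2 ^ wsB else if 1 ≤ b ∧ b ≤ j then dmem (a + (b - 1)) % 2 ^ wsB else 0

/-- The `B`-side source memory before the copy-in loop. [folklore] -/
theorem dmB_zero (dmem : ℕ → ℕ) (wsB L a : ℕ) :
    dmB dmem wsB L a 0 = Function.update (fun _ => 0) 0 (L % 2 ^ wsB) := by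
  funext b; simp only [dmB, Function.update_apply]
  split_ifs <;> first | rfl | omega

/-- The `B`-side source memory after one more copy-in round. [folklore] -/
theorem dmB_succ (dmem : ℕ → ℕ) (wsB L a j : ℕ) :
    dmB dmem wsB L a (j + 1) = Function.update (dmB dmem wsB L a j) (1 + j) (dmem (a + j) % 2 ^ wsB) := by
  funext b; simp only [dmB, Function.update_apply]
  by_cases hb : b = 1 + j
  · subst hb; simp [show 1 ≤ 1 + j ∧ 1 + j ≤ j + 1 from ⟨by omega, by omega⟩]
  · simp only [hb, if_false]
    split_ifs <;> first | rfl | omega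

/-- After all `L` rounds the emulated `M_B`-memory is `init wsB q` for the query segment `q`. [folklore] -/
theorem dmB_eq_init {dmem : ℕ → ℕ} {wsB L a : ℕ} (b : ℕ) :
    dmB dmem wsB L a L b = (init wsB (readSeg dmem a L)).mem b := by
  simp only [dmB]
  rcases b with _ | b
  · simp [init_mem_zero]
  · simp only [Nat.succ_ne_zero, if_false, Nat.add_sub_cancel]
    by_cases hb : b < L
    · rw [if_pos (by omega), init_mem_succ _ _ _ (by simpa using hb)]
      simp [readSeg, List.getElem_map, List.getElem_range]
    · rw [if_neg (by omega), init_mem_of_length_lt _ _ _ (by simp; omega)]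

/-- **One copy-in round.** [folklore] -/
theorem execOps_cinBody (hVT : VT + 1 = 2 ^ W) {mem dmem : ℕ → ℕ}
    {g wsB L a j : ℕ} (hwsB : wsB ≤ W) (hM : MSide W ws VT dmem mem)
    (hB : BSide W g wsB VT (dmB dmem wsB L a j) mem)
    (h19 : mem 19 = 40 + a + j) (h20 : mem 20 = L - j) (h32 : mem 32 = 1 + j)
    (hjL : j < L) (haL : a + L < Qv W - 40) :
    MSide W ws VT dmem (execOps W mem cinBody) ∧
      BSide W g wsB VT (dmB dmem wsB L a (j + 1)) (execOps W mem cinBody) ∧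
      (execOps W mem cinBody) 19 = 40 + a + (j + 1) ∧ (execOps W mem cinBody) 20 = L - (j + 1) ∧
      (execOps W mem cinBody) 32 = 1 + (j + 1) ∧
      ∀ c, c ≠ 12 → c ≠ 14 → c ≠ 19 → c ≠ 20 → c ≠ 32 → ¬ (2 * Qv W ≤ c ∧ c < 4 * Qv W) →
        (execOps W mem cinBody) c = mem c := by
  have hW : 8 ≤ W := eight_le_of_Qv (by omega)
  have hLQ : L + 1 < Qv W := by omega
  have hOKB := envOK_B (g := g) hW hwsB
  have hQ := Qv_ge hW
  have h4Q := four_mul_Qv (show 2 ≤ W by omega)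
  have h255 : 255 ≤ VT := by
    have : 2 ^ 8 ≤ 2 ^ W := Nat.pow_le_pow_right (by norm_num) hW
    omega
  have hP : mem 11 = 2 ^ wsB := by have := hB.1.env.2.2.2; simpa using this
  -- the source word
  have hsrc : mem (40 + a + j) = dmem (a + j) := by
    have := hM.2 (a + j) (by simp only [EM_Q]; omega)
    rw [edec_M_eq hM.1.stamp (by omega)] at this
    simpa only [Nat.add_assoc] using this
  rw [cinBody, execOps_append, execOps_append]
  -- ops 1–2
  set m₁ := execOps W mem [(.div, .dir 12, .ind 19, .imm 1), (.mod, .dir 12, .dir 12, .dir 11)] with hm₁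
  have hm₁v : m₁ = Function.update mem 12 (dmem (a + j) % 2 ^ wsB) := by
    simp only [hm₁, execOps_cons, execOps_nil, execOp_dir, Operand.read_dir, Operand.read_ind,
      Operand.read_imm, BinOp.eval, Nat.div_one, h19, hsrc]
    simp (config := { decide := true }) only [Function.update_self, Function.update_of_ne, ne_eq,
      hP, Function.update_idem]
  have hf₁ : ∀ c, c ≠ 12 → m₁ c = mem c := fun c hc => by rw [hm₁v, Function.update_of_ne hc]
  have hT₁ : MemLE VT m₁ := by
    intro c; rw [hm₁v]
    rcases eq_or_ne c 12 with rfl | hc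
    · rw [Function.update_self]
      have := hM.1.memT (40 + a + j); rw [hsrc] at this
      exact le_trans (Nat.mod_le _ _) this
    · rw [Function.update_of_ne hc]; exact hM.1.memT c
  have hM₁ : MSide W ws VT dmem m₁ := hM.of_frame hW hT₁ fun c hc => hf₁ c (by omega)
  have hB₁ : BSide W g wsB VT (dmB dmem wsB L a j) m₁ := hB.of_frame hW hT₁ fun c hc => hf₁ c (by omega)
  -- op 3: the stamped write
  have h32₁ : m₁ 32 = 1 + j := by rw [hf₁ _ (by decide), h32]
  obtain ⟨hIB, hagB, hf₂⟩ := execOps_ewrAt_agree hOKB hVT hB₁.1 hB₁.2 (dst := .dir 32) (Tv := 12)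
    (operandStable_dir fun c hc => by
      simp only [LB_ta, EB_Bv, EB_Sv] at hc; omega)
    (by simp) (by simp only [Operand.read_dir, EB_Q, h32₁]; omega) (by simp only [Operand.const_dir]; omega)
    (by omega) (by omega)
  simp only [Operand.read_dir, LB_ta, EB_Bv, EB_Sv, h32₁] at hagB hf₂
  set m₂ := execOps W m₁ (ewrAt LB (.dir 32) 12) with hm₂
  have h12₁ : m₁ 12 = dmem (a + j) % 2 ^ wsB := by rw [hm₁v, Function.update_self]
  rw [h12₁, ← dmB_succ] at hagB
  have hM₂ : MSide W ws VT dmem m₂ :=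
    hM₁.of_frame hW hIB.memT fun c hc => hf₂ c (by omega) (by omega) (by omega)
  -- ops 4–6: registers
  have h32₂ : m₂ 32 = 1 + j := by rw [hf₂ _ (by omega) (by omega) (by omega), h32₁]
  have h19₂ : m₂ 19 = 40 + a + j := by rw [hf₂ _ (by omega) (by omega) (by omega), hf₁ _ (by decide), h19]
  have h20₂ : m₂ 20 = L - j := by rw [hf₂ _ (by omega) (by omega) (by omega), hf₁ _ (by decide), h20]
  set m₃ := execOps W m₂ [(.add, .dir 32, .dir 32, .imm 1), (.add, .dir 19, .dir 19, .imm 1),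
    (.sub, .dir 20, .dir 20, .imm 1)] with hm₃
  have hm₃v : m₃ = Function.update (Function.update (Function.update m₂ 32 (1 + (j + 1))) 19
      (40 + a + (j + 1))) 20 (L - (j + 1)) := by
    simp only [hm₃, execOps_cons, execOps_nil, execOp_dir, Operand.read_dir, Operand.read_imm,
      BinOp.eval, h32₂]
    simp (config := { decide := true }) only [Function.update_of_ne, ne_eq,
      h19₂, h20₂,
      Nat.mod_eq_of_lt (show 1 + (j + 1) < 2 ^ W by omega),
      Nat.mod_eq_of_lt (show 40 + a + (j + 1) < 2 ^ W by omega),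
      sub_eval_of_le (show 1 ≤ L - j by omega) (show L - j < 2 ^ W by omega),
      show 1 + j + 1 = 1 + (j + 1) by omega, show 40 + a + j + 1 = 40 + a + (j + 1) by omega,
      show L - j - 1 = L - (j + 1) by omega]
  have hf₃ : ∀ c, c ≠ 19 → c ≠ 20 → c ≠ 32 → m₃ c = m₂ c := fun c c19 c20 c32 => by
    rw [hm₃v, Function.update_of_ne c20, Function.update_of_ne c19, Function.update_of_ne c32]
  have hT₃ : MemLE VT m₃ := by
    intro c; rw [hm₃v]; simp only [Function.update_apply]
    split_ifs
    · omega
    · omega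
    · omega
    · exact hIB.memT c
  refine ⟨hM₂.of_frame hW hT₃ fun c hc => hf₃ c (by omega) (by omega) (by omega),
    (show BSide W g wsB VT _ m₂ from ⟨hIB, hagB⟩).of_frame hW hT₃ fun c hc => hf₃ c (by omega) (by omega) (by omega),
    by rw [hm₃v]; simp, by rw [hm₃v]; simp, by rw [hm₃v]; simp (config := { decide := true }),
    fun c c12 c14 c19 c20 c32 cB => ?_⟩
  rw [hf₃ c c19 c20 c32, hf₂ c c14 (by omega) (by omega), hf₁ c c12]

/-- **The copy-in loop**: after `j ≤ L` rounds. [folklore] -/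
theorem iterate_cinBody (hVT : VT + 1 = 2 ^ W) {mem dmem : ℕ → ℕ}
    {g wsB L a : ℕ} (hwsB : wsB ≤ W) (hM : MSide W ws VT dmem mem)
    (hB : BSide W g wsB VT (dmB dmem wsB L a 0) mem)
    (h19 : mem 19 = 40 + a) (h20 : mem 20 = L) (h32 : mem 32 = 1)
    (haL : a + L < Qv W - 40) :
    ∀ j, j ≤ L →
      MSide W ws VT dmem ((fun m => execOps W m cinBody)^[j] mem) ∧
      BSide W g wsB VT (dmB dmem wsB L a j) ((fun m => execOps W m cinBody)^[j] mem) ∧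
      ((fun m => execOps W m cinBody)^[j] mem) 19 = 40 + a + j ∧
      ((fun m => execOps W m cinBody)^[j] mem) 20 = L - j ∧
      ((fun m => execOps W m cinBody)^[j] mem) 32 = 1 + j ∧
      ∀ c, c ≠ 12 → c ≠ 14 → c ≠ 19 → c ≠ 20 → c ≠ 32 → ¬ (2 * Qv W ≤ c ∧ c < 4 * Qv W) →
        ((fun m => execOps W m cinBody)^[j] mem) c = mem c
  | 0, _ => ⟨hM, hB, by simpa using h19, by simpa using h20, by simpa using h32, fun _ _ _ _ _ _ _ => rfl⟩
  | j + 1, hj => by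
      obtain ⟨iM, iB, i19, i20, i32, i_f⟩ := iterate_cinBody hVT hwsB hM hB h19 h20 h32 haL j
        (by omega)
      rw [Function.iterate_succ_apply']
      obtain ⟨jM, jB, j19, j20, j32, jf⟩ := execOps_cinBody hVT hwsB iM iB i19 i20 i32 (by omega) haL
      exact ⟨jM, jB, j19, j20, j32, fun c c12 c14 c19 c20 c32 cB => by
        rw [jf c c12 c14 c19 c20 c32 cB, i_f c c12 c14 c19 c20 c32 cB]⟩


/-! ## Phase 5 and the copy-out loop -/

/-- Phase 5: with the halting memory `cBmem` of `M_B` emulated (agreement) and `ad` in register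
`17`: afterwards register `34` and `M`-cell `ad` hold `cBmem 0` (the answer length), registers
`33, 32, 20` hold `ad + 1, 1, cBmem 0`; the `B`-side is kept. [folklore] -/
theorem execOps_Q5 (hws : ws ≤ W) (hVT : VT + 1 = 2 ^ W) {mem dmem cBmem : ℕ → ℕ}
    {g wsB ad : ℕ} (hwsB : wsB ≤ W) (hM : MSide W ws VT dmem mem) (hB : BSide W g wsB VT cBmem mem)
    (h17 : mem 17 = ad) (had : ad < Qv W - 40) (hlen : cBmem 0 + ad + 1 < 2 ^ W) :
    MSide W ws VT (Function.update dmem ad (cBmem 0)) (execOps W mem Q5) ∧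
      BSide W g wsB VT cBmem (execOps W mem Q5) ∧
      (execOps W mem Q5) 34 = cBmem 0 ∧ (execOps W mem Q5) 33 = ad + 1 ∧
      (execOps W mem Q5) 32 = 1 ∧ (execOps W mem Q5) 20 = cBmem 0 ∧
      ∀ c, c ≠ 14 → c ≠ 20 → c ≠ 32 → c ≠ 33 → c ≠ 34 → ¬ (40 ≤ c ∧ c < 2 * Qv W) →
        (execOps W mem Q5) c = mem c := by
  have hW : 8 ≤ W := eight_le_of_Qv (by omega)
  have hOKM := envOK_M hW hws
  have hOKB := envOK_B (g := g) hW hwsB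
  have hQ := Qv_ge hW
  have h4Q := four_mul_Qv (show 2 ≤ W by omega)
  have h255 : 255 ≤ VT := by
    have : 2 ^ 8 ≤ 2 ^ W := Nat.pow_le_pow_right (by norm_num) hW
    omega
  rw [Q5, execOps_append, execOps_append]
  -- read B-cell 0 into register 34
  obtain ⟨hIB, hv₁, hf₁⟩ := hB.1.erdAt hOKB hVT (src := .imm 0) (T := 34) (operandStable_imm 0 _)
    (by simp) (by simp) (by simp only [EB_Bv, EB_Sv]; omega) (by simp only [Operand.read_imm, EB_Q]; omega)
    (by simp) (by omega) (by omega)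
  simp only [Operand.read_imm, LB_ta] at hv₁ hf₁
  set m₁ := execOps W mem (erdAt LB (.imm 0) 34) with hm₁
  have h34 : m₁ 34 = cBmem 0 := by rw [hv₁]; exact hB.2 0 (by simp only [EB_Q]; omega)
  have hB₁ : BSide W g wsB VT cBmem m₁ := hB.of_frame hW hIB.memT fun c hc => hf₁ c (by omega) (by omega)
  have hM₁ : MSide W ws VT dmem m₁ := hM.of_frame hW hIB.memT fun c hc => hf₁ c (by omega) (by omega)
  -- write it to M-cell `ad`
  have h17₁ : m₁ 17 = ad := by rw [hf₁ _ (by decide) (by decide), h17]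
  obtain ⟨hIM, hagM, hf₂⟩ := execOps_ewrAt_agree hOKM hVT hM₁.1 hM₁.2 (dst := .dir 17) (Tv := 34)
    (operandStable_dir fun c hc => by simp only [LM_ta, EM_Bv, EM_Sv] at hc; omega)
    (by simp) (by simp only [Operand.read_dir, EM_Q, h17₁]; exact had) (by simp only [Operand.const_dir]; omega)
    (by omega) (by omega)
  simp only [Operand.read_dir, LM_ta, EM_Bv, EM_Sv, h17₁, h34] at hagM hf₂
  set m₂ := execOps W m₁ (ewrAt LM (.dir 17) 34) with hm₂
  have hB₂ : BSide W g wsB VT cBmem m₂ :=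
    hB₁.of_frame hW hIM.memT fun c hc => hf₂ c (by omega) (by omega) (by omega)
  -- registers
  have h17₂ : m₂ 17 = ad := by rw [hf₂ _ (by omega) (by omega) (by omega), h17₁]
  have h34₂ : m₂ 34 = cBmem 0 := by rw [hf₂ _ (by omega) (by omega) (by omega), h34]
  set m₃ := execOps W m₂ [(.add, .dir 33, .dir 17, .imm 1), (.div, .dir 32, .imm 1, .imm 1),
    (.div, .dir 20, .dir 34, .imm 1)] with hm₃
  have hm₃v : m₃ = Function.update (Function.update (Function.update m₂ 33 (ad + 1)) 32 1) 20 (cBmem 0) := by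
    simp only [hm₃, execOps_cons, execOps_nil, execOp_dir, Operand.read_dir, Operand.read_imm,
      BinOp.eval, Nat.div_one, h17₂]
    simp (config := { decide := true }) only [Function.update_of_ne, ne_eq,
      h34₂, Nat.mod_eq_of_lt (show ad + 1 < 2 ^ W by omega)]
  have hf₃ : ∀ c, c ≠ 20 → c ≠ 32 → c ≠ 33 → m₃ c = m₂ c := fun c c20 c32 c33 => by
    rw [hm₃v, Function.update_of_ne c20, Function.update_of_ne c32, Function.update_of_ne c33]
  have hT₃ : MemLE VT m₃ := by
    intro c; rw [hm₃v]; simp only [Function.update_apply]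
    split_ifs
    · rw [← h34₂]; exact hIM.memT 34
    · omega
    · omega
    · exact hIM.memT c
  refine ⟨(show MSide W ws VT _ m₂ from ⟨hIM, hagM⟩).of_frame hW hT₃ fun c hc => hf₃ c (by omega) (by omega) (by omega),
    hB₂.of_frame hW hT₃ fun c hc => hf₃ c (by omega) (by omega) (by omega),
    by rw [hf₃ _ (by decide) (by decide) (by decide), h34₂], by rw [hm₃v]; simp (config := { decide := true }),
    by rw [hm₃v]; simp (config := { decide := true }), by rw [hm₃v]; simp,
    fun c c14 c20 c32 c33 c34 cM => ?_⟩
  rw [hf₃ c c20 c32 c33, hf₂ c c14 (by omega) (by omega), hf₁ c c34 c14]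

/-- The emulated `M`-memory after `j` copy-out rounds: the answer words `oq[0 … j)` reduced modulo
`2 ^ ws` at `ad + 1 …`, on top of `dm₁`. [folklore] -/
def dmM (dm₁ : ℕ → ℕ) (oq : List ℕ) (ws ad j : ℕ) : ℕ → ℕ := fun b =>
  if h : ad + 1 ≤ b ∧ b < ad + 1 + j ∧ b - (ad + 1) < oq.length then oq[b - (ad + 1)] % 2 ^ ws else dm₁ b

/-- The `M`-side source memory before the copy-out loop. [folklore] -/
theorem dmM_zero (dm₁ : ℕ → ℕ) (oq : List ℕ) (ws ad : ℕ) : dmM dm₁ oq ws ad 0 = dm₁ := by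
  funext b; simp only [dmM]; rw [dif_neg (by omega)]

/-- The `M`-side source memory after one more copy-out round. [folklore] -/
theorem dmM_succ (dm₁ : ℕ → ℕ) (oq : List ℕ) (ws ad j : ℕ) (hj : j < oq.length) :
    dmM dm₁ oq ws ad (j + 1) = Function.update (dmM dm₁ oq ws ad j) (ad + 1 + j) (oq[j] % 2 ^ ws) := by
  funext b; simp only [dmM, Function.update_apply]
  by_cases hb : b = ad + 1 + j
  · subst hb
    rw [dif_pos ⟨by omega, by omega, by rw [Nat.add_sub_cancel_left]; exact hj⟩, if_pos rfl]
    simp only [Nat.add_sub_cancel_left]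
  · rw [if_neg hb]
    by_cases h : ad + 1 ≤ b ∧ b < ad + 1 + j ∧ b - (ad + 1) < oq.length
    · rw [dif_pos ⟨h.1, by omega, h.2.2⟩, dif_pos h]
    · rw [dif_neg (fun h' => h ⟨h'.1, by omega, h'.2.2⟩), dif_neg h]

/-- After all rounds the emulated `M`-memory is `writeSeg dm₁ (ad + 1) (oq.map (· % 2 ^ ws))`,
the effect of the query on the memory of `M`. [folklore] -/
theorem dmM_length (dm₁ : ℕ → ℕ) (oq : List ℕ) (ws ad : ℕ) :
    dmM dm₁ oq ws ad oq.length = writeSeg dm₁ (ad + 1) (oq.map (· % 2 ^ ws)) := by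
  funext b
  rw [writeSeg_apply]
  simp only [dmM, List.length_map]
  by_cases h : ad + 1 ≤ b ∧ b < ad + 1 + oq.length
  · rw [dif_pos ⟨h.1, h.2, by omega⟩, dif_pos h, List.getElem_map]
  · rw [dif_neg (fun h' => h ⟨h'.1, h'.2.1⟩), dif_neg h]

/-- **One copy-out round.** [folklore] -/
theorem execOps_coutBody (hws : ws ≤ W) (hVT : VT + 1 = 2 ^ W) {mem dm₁ cBmem : ℕ → ℕ}
    {oq : List ℕ} {g wsB ad j : ℕ} (hwsB : wsB ≤ W) (hM : MSide W ws VT (dmM dm₁ oq ws ad j) mem)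
    (hB : BSide W g wsB VT cBmem mem) (hout : ∀ i, i < oq.length → cBmem (1 + i) = oq[i]!)
    (h32 : mem 32 = 1 + j) (h33 : mem 33 = ad + 1 + j) (h20 : mem 20 = oq.length - j)
    (hj : j < oq.length) (hadQ : ad + 1 + oq.length < Qv W - 40) :
    MSide W ws VT (dmM dm₁ oq ws ad (j + 1)) (execOps W mem coutBody) ∧
      BSide W g wsB VT cBmem (execOps W mem coutBody) ∧
      (execOps W mem coutBody) 32 = 1 + (j + 1) ∧ (execOps W mem coutBody) 33 = ad + 1 + (j + 1) ∧
      (execOps W mem coutBody) 20 = oq.length - (j + 1) ∧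
      ∀ c, c ≠ 12 → c ≠ 14 → c ≠ 20 → c ≠ 32 → c ≠ 33 → ¬ (40 ≤ c ∧ c < 2 * Qv W) →
        (execOps W mem coutBody) c = mem c := by
  have hW : 8 ≤ W := eight_le_of_Qv (by omega)
  have hoQ : oq.length + 1 < Qv W := by omega
  have hOKM := envOK_M hW hws
  have hOKB := envOK_B (g := g) hW hwsB
  have hQ := Qv_ge hW
  have h4Q := four_mul_Qv (show 2 ≤ W by omega)
  have h255 : 255 ≤ VT := by
    have : 2 ^ 8 ≤ 2 ^ W := Nat.pow_le_pow_right (by norm_num) hW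
    omega
  have hPA : mem 7 = 2 ^ ws := by have := hM.1.env.2.2.2; simpa using this
  rw [coutBody, execOps_append, execOps_append, execOps_append]
  -- read B-cell `1 + j`
  obtain ⟨hIB, hv₁, hf₁⟩ := hB.1.erdAt hOKB hVT (src := .dir 32) (T := 12)
    (operandStable_dir fun c hc => by simp only [LB_ta] at hc; omega)
    (by simp) (by simp) (by simp only [EB_Bv, EB_Sv]; omega)
    (by simp only [Operand.read_dir, EB_Q, h32]; omega) (by simp only [Operand.const_dir]; omega)
    (by omega) (by omega)
  simp only [Operand.read_dir, LB_ta, h32] at hv₁ hf₁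
  set m₁ := execOps W mem (erdAt LB (.dir 32) 12) with hm₁
  have h12₁ : m₁ 12 = oq[j]! := by
    rw [hv₁, hB.2 _ (by simp only [EB_Q]; omega)]; exact hout j hj
  have hB₁ : BSide W g wsB VT cBmem m₁ := hB.of_frame hW hIB.memT fun c hc => hf₁ c (by omega) (by omega)
  have hM₁ : MSide W ws VT (dmM dm₁ oq ws ad j) m₁ :=
    hM.of_frame hW hIB.memT fun c hc => hf₁ c (by omega) (by omega)
  -- reduce modulo `2 ^ ws`
  set m₂ := execOps W m₁ [(.mod, .dir 12, .dir 12, .dir 7)] with hm₂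
  have hm₂v : m₂ = Function.update m₁ 12 (oq[j]! % 2 ^ ws) := by
    simp only [hm₂, execOps_cons, execOps_nil, execOp_dir, Operand.read_dir, BinOp.eval, h12₁,
      hf₁ 7 (by decide) (by decide), hPA]
  have hf₂ : ∀ c, c ≠ 12 → m₂ c = m₁ c := fun c hc => by rw [hm₂v, Function.update_of_ne hc]
  have hT₂ : MemLE VT m₂ := by
    intro c; rw [hm₂v]
    rcases eq_or_ne c 12 with rfl | hc
    · rw [Function.update_self]; exact le_trans (Nat.mod_le _ _) (h12₁ ▸ hIB.memT 12)
    · rw [Function.update_of_ne hc]; exact hIB.memT c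
  have hM₂ : MSide W ws VT (dmM dm₁ oq ws ad j) m₂ := hM₁.of_frame hW hT₂ fun c hc => hf₂ c (by omega)
  have hB₂ : BSide W g wsB VT cBmem m₂ := hB₁.of_frame hW hT₂ fun c hc => hf₂ c (by omega)
  -- write to M-cell `ad + 1 + j`
  have h33₂ : m₂ 33 = ad + 1 + j := by rw [hf₂ _ (by decide), hf₁ _ (by decide) (by decide), h33]
  obtain ⟨hIM, hagM, hf₃⟩ := execOps_ewrAt_agree hOKM hVT hM₂.1 hM₂.2 (dst := .dir 33) (Tv := 12)
    (operandStable_dir fun c hc => by simp only [LM_ta, EM_Bv, EM_Sv] at hc; omega)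
    (by simp) (by simp only [Operand.read_dir, EM_Q, h33₂]; omega) (by simp only [Operand.const_dir]; omega)
    (by omega) (by omega)
  simp only [Operand.read_dir, LM_ta, EM_Bv, EM_Sv, h33₂] at hagM hf₃
  set m₃ := execOps W m₂ (ewrAt LM (.dir 33) 12) with hm₃
  have h12₂ : m₂ 12 = oq[j]! % 2 ^ ws := by rw [hm₂v, Function.update_self]
  rw [h12₂, getElem!_pos oq j hj, ← dmM_succ dm₁ oq ws ad j hj] at hagM
  have hB₃ : BSide W g wsB VT cBmem m₃ :=
    hB₂.of_frame hW hIM.memT fun c hc => hf₃ c (by omega) (by omega) (by omega)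
  -- registers
  have h32₃ : m₃ 32 = 1 + j := by
    rw [hf₃ _ (by omega) (by omega) (by omega), hf₂ _ (by decide), hf₁ _ (by decide) (by decide), h32]
  have h33₃ : m₃ 33 = ad + 1 + j := by rw [hf₃ _ (by omega) (by omega) (by omega), h33₂]
  have h20₃ : m₃ 20 = oq.length - j := by
    rw [hf₃ _ (by omega) (by omega) (by omega), hf₂ _ (by decide), hf₁ _ (by decide) (by decide), h20]
  set m₄ := execOps W m₃ [(.add, .dir 32, .dir 32, .imm 1), (.add, .dir 33, .dir 33, .imm 1),
    (.sub, .dir 20, .dir 20, .imm 1)] with hm₄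
  have hm₄v : m₄ = Function.update (Function.update (Function.update m₃ 32 (1 + (j + 1))) 33
      (ad + 1 + (j + 1))) 20 (oq.length - (j + 1)) := by
    simp only [hm₄, execOps_cons, execOps_nil, execOp_dir, Operand.read_dir, Operand.read_imm,
      BinOp.eval, h32₃]
    simp (config := { decide := true }) only [Function.update_of_ne, ne_eq,
      h33₃, h20₃,
      Nat.mod_eq_of_lt (show 1 + (j + 1) < 2 ^ W by omega),
      Nat.mod_eq_of_lt (show ad + 1 + (j + 1) < 2 ^ W by omega),
      sub_eval_of_le (show 1 ≤ oq.length - j by omega) (show oq.length - j < 2 ^ W by omega),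
      show 1 + j + 1 = 1 + (j + 1) by omega, show ad + 1 + j + 1 = ad + 1 + (j + 1) by omega,
      show oq.length - j - 1 = oq.length - (j + 1) by omega]
  have hf₄ : ∀ c, c ≠ 20 → c ≠ 32 → c ≠ 33 → m₄ c = m₃ c := fun c c20 c32 c33 => by
    rw [hm₄v, Function.update_of_ne c20, Function.update_of_ne c33, Function.update_of_ne c32]
  have hT₄ : MemLE VT m₄ := by
    intro c; rw [hm₄v]; simp only [Function.update_apply]
    split_ifs
    · omega
    · omega
    · omega
    · exact hIM.memT c
  refine ⟨(show MSide W ws VT _ m₃ from ⟨hIM, hagM⟩).of_frame hW hT₄ fun c hc => hf₄ c (by omega) (by omega) (by omega),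
    hB₃.of_frame hW hT₄ fun c hc => hf₄ c (by omega) (by omega) (by omega),
    by rw [hm₄v]; simp (config := { decide := true }), by rw [hm₄v]; simp (config := { decide := true }),
    by rw [hm₄v]; simp, fun c c12 c14 c20 c32 c33 cM => ?_⟩
  rw [hf₄ c c20 c32 c33, hf₃ c c14 (by omega) (by omega), hf₂ c c12, hf₁ c c12 c14]

/-- **The copy-out loop**: after `j ≤ |oq|` rounds. [folklore] -/
theorem iterate_coutBody (hws : ws ≤ W) (hVT : VT + 1 = 2 ^ W) {mem dm₁ cBmem : ℕ → ℕ}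
    {oq : List ℕ} {g wsB ad : ℕ} (hwsB : wsB ≤ W) (hM : MSide W ws VT dm₁ mem)
    (hB : BSide W g wsB VT cBmem mem) (hout : ∀ i, i < oq.length → cBmem (1 + i) = oq[i]!)
    (h32 : mem 32 = 1) (h33 : mem 33 = ad + 1) (h20 : mem 20 = oq.length)
    (hadQ : ad + 1 + oq.length < Qv W - 40) :
    ∀ j, j ≤ oq.length →
      MSide W ws VT (dmM dm₁ oq ws ad j) ((fun m => execOps W m coutBody)^[j] mem) ∧
      BSide W g wsB VT cBmem ((fun m => execOps W m coutBody)^[j] mem) ∧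
      ((fun m => execOps W m coutBody)^[j] mem) 32 = 1 + j ∧
      ((fun m => execOps W m coutBody)^[j] mem) 33 = ad + 1 + j ∧
      ((fun m => execOps W m coutBody)^[j] mem) 20 = oq.length - j ∧
      ∀ c, c ≠ 12 → c ≠ 14 → c ≠ 20 → c ≠ 32 → c ≠ 33 → ¬ (40 ≤ c ∧ c < 2 * Qv W) →
        ((fun m => execOps W m coutBody)^[j] mem) c = mem c
  | 0, _ => ⟨by rw [dmM_zero]; exact hM, hB, by simpa using h32, by simpa using h33, by simpa using h20,
      fun _ _ _ _ _ _ _ => rfl⟩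
  | j + 1, hj => by
      obtain ⟨iM, iB, i32, i33, i20, i_f⟩ := iterate_coutBody hws hVT hwsB hM hB hout h32 h33 h20 hadQ
        j (by omega)
      rw [Function.iterate_succ_apply']
      obtain ⟨jM, jB, j32, j33, j20, jf⟩ := execOps_coutBody hws hVT hwsB iM iB hout i32 i33 i20
        (by omega) hadQ
      exact ⟨jM, jB, j32, j33, j20, fun c c12 c14 c20 c32 c33 cM => by
        rw [jf c c12 c14 c20 c32 c33 cM, i_f c c12 c14 c20 c32 c33 cM]⟩

end phases

/-! ## The whole query block -/

section whole

variable {W ws VT V : ℕ}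

/-- The `M`-region reads as the source memory: a query segment of `M` is a target segment. [folklore] -/
theorem readSeg_M_eq {mem dmem : ℕ → ℕ} (hM : MSide W ws VT dmem mem) {a L : ℕ}
    (haL : a + L ≤ Qv W - 40) : readSeg mem (40 + a) L = readSeg dmem a L := by
  apply List.ext_getElem (by simp)
  intro j hj _
  simp only [readSeg, List.getElem_map, List.getElem_range]
  rw [readSeg_length] at hj
  have := hM.2 (a + j) (by simp only [EM_Q]; omega)
  rw [edec_M_eq hM.1.stamp (by omega)] at this
  simpa only [Nat.add_assoc] using this

/-- Agreement is invariant under pointwise-equal source memories. [folklore] -/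
theorem Agree.congr_right {E : Env} {mem dm dm' : ℕ → ℕ} (h : Agree E mem dm) (heq : ∀ b, dm b = dm' b) :
    Agree E mem dm' := fun a ha => (h a ha).trans (heq a)

/-- The cost of the query block: length `L` of the query, `sq` steps of `M_B`, answer of length `lo`. [folklore] -/
def qbCost (L W sq lo : ℕ) : ℕ := 20 * L + 20 * Nat.size W + 38 * sq + 16 * lo + 77

/-- **Specification of the query block.** Let the query block for `query qa ql aa` sit at `pos`,
let the target configuration `e` (at `pos`) carry the `M`-side for the `V`-bounded source memory
`dmem` and the `B`-side between calls (`BPre`) at generation `g` (register `10`), and let the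
deterministic oracle-free
`M_B`, run at word size `kB * inputWidth q` on the query segment
`q = readSeg dmem (qa.read dmem) (ql.read dmem)`, halt within `sq` steps in `cB` with output `oq`,
`|oq| ≤ V`. Then, under the numeric side conditions, the target reaches the end of the block within
`qbCost |q| W sq |oq|` steps, its `M`-side now agreeing with the memory of `M` *after* the query
answered by `oq` (`WordRAM.step`: length at `aa`, words reduced modulo `2 ^ ws` after it), its
`B`-side at generation `g + 1`, coins and query log unchanged. [folklore] -/
theorem run_QB {P : Program} {MB : Program} {kB pos : ℕ} {qa ql aa : Operand}
    (hcode : CodeAt P pos (QB MB kB pos qa ql aa)) (hws : ws < W) (hVT : VT + 1 = 2 ^ W)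
    (hBdet : MB.IsDeterministic) (hBof : MB.IsOracleFree)
    {e : Cfg} (hpc : e.pc = some pos) {dmem : ℕ → ℕ} (hM : MSide W ws VT dmem e.mem)
    {g : ℕ} (hB : BPre W g e.mem) (h10 : e.mem 10 = g)
    (hdm : MemLE V dmem) (hqa : qa.const ≤ V) (hql : ql.const ≤ V) (haa : aa.const ≤ V) (hV1 : 1 ≤ V)
    {oq : List ℕ} {sq : ℕ} {cB : Cfg}
    (hrunB : HaltsWithin MB (kB * inputWidth (readSeg dmem (qa.read dmem) (ql.read dmem))) noOracle
      zeroCoins (readSeg dmem (qa.read dmem) (ql.read dmem)) sq cB)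
    (houtB : readOut cB.mem = oq) (hoV : oq.length ≤ V)
    (hVQ : 2 * V + 42 ≤ Qv W - 40) (hgT : g + 1 ≤ VT) (hkB : kB * Nat.size V < W) {VB : ℕ}
    (hVB : 2 ^ (kB * Nat.size V) ≤ VB) (hMB : MB.maxConst ≤ VB) (hVBQ : VB < Qv W)
    (O' : List ℕ → List ℕ) (ρ' : ℕ → ℕ) :
    ∃ n, n ≤ qbCost (ql.read dmem) W sq oq.length ∧ ∃ e' : Cfg, run P W O' ρ' n e = some e' ∧
      e'.pc = some (pos + qlenM MB) ∧
      MSide W ws VT (writeSeg (Function.update dmem (aa.read dmem) (oq.map (· % 2 ^ ws)).length)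
        (aa.read dmem + 1) (oq.map (· % 2 ^ ws))) e'.mem ∧
      (∃ wsB, BSide W (g + 1) wsB VT cB.mem e'.mem) ∧ e'.mem 10 = g + 1 ∧
      e'.coinPos = e.coinPos ∧ e'.queries = e.queries := by
  -- code placement
  simp only [QB] at hcode
  obtain ⟨hc0, hc8⟩ := codeAt_append_iff.1 hcode
  obtain ⟨hc0, hc7⟩ := codeAt_append_iff.1 hc0
  obtain ⟨hc0, hc6⟩ := codeAt_append_iff.1 hc0
  obtain ⟨hc0, hc5⟩ := codeAt_append_iff.1 hc0
  obtain ⟨hc0, hc4⟩ := codeAt_append_iff.1 hc0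
  obtain ⟨hc0, hc3⟩ := codeAt_append_iff.1 hc0
  obtain ⟨hc0, hc2⟩ := codeAt_append_iff.1 hc0
  obtain ⟨hc0, hc1⟩ := codeAt_append_iff.1 hc0
  simp only [List.length_append, List.length_map, loopBlock_length, Q0_length, Q1_length,
    widthCode_length, Q2_length, Q3_length, cinBody_length, Q5_length, length_compile_B,
    Nat.add_assoc, Nat.reduceAdd] at hc1 hc2 hc3 hc4 hc5 hc6 hc7 hc8
  -- constants
  have hW : 8 ≤ W := eight_le_of_Qv (by omega)
  have hOKM := envOK_M hW hws.le
  have hQ := Qv_ge hW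
  have h4Q := four_mul_Qv (show 2 ≤ W by omega)
  have h255 : 255 ≤ VT := by
    have : 2 ^ 8 ≤ 2 ^ W := Nat.pow_le_pow_right (by norm_num) hW
    omega
  have hVVT : V ≤ VT := by omega
  have hVBT : VB ≤ VT := by omega
  set a := qa.read dmem with ha
  set L := ql.read dmem with hL
  set ad := aa.read dmem with had
  have haV : a ≤ V := Operand.read_le hdm qa hqa
  have hLV : L ≤ V := Operand.read_le hdm ql hql
  have hadV : ad ≤ V := Operand.read_le hdm aa haa
  set q := readSeg dmem a L with hq
  have hqlen : q.length = L := readSeg_length _ _ _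
  have hiw : inputWidth q ≤ Nat.size V := by
    refine inputWidth_le_size (by rw [hqlen]; exact hLV) hV1 fun v hv => ?_
    obtain ⟨j, -, rfl⟩ := mem_readSeg_iff.1 hv
    exact hdm _
  obtain ⟨wsB, hwsB⟩ : ∃ wsB, kB * inputWidth q = wsB := ⟨_, rfl⟩
  have hwsBW : wsB < W := by rw [← hwsB]; exact lt_of_le_of_lt (Nat.mul_le_mul_left kB hiw) hkB
  have hwsBV : 2 ^ wsB - 1 ≤ VB := by
    rw [← hwsB]
    have := Nat.pow_le_pow_right (show 0 < 2 by norm_num) (Nat.mul_le_mul_left kB hiw); omega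
  have hVB1 : 1 ≤ VB := le_trans Nat.one_le_two_pow hVB
  rw [hwsB] at hrunB
  obtain ⟨pc0, m0, cp, qs⟩ := e
  simp only at hpc hM hB h10
  subst hpc
  -- phase 0 (36 steps)
  obtain ⟨M1, r15, r16, r17, f1⟩ := execOps_Q0 hws.le hVT hM hdm (by omega) hVVT qa ql aa hqa hql haa
  have r1 := run_ops (P := P) (w := W) (O := O') (ρ := ρ') (Q0 qa ql aa) hc0 (c := ⟨some pos, m0, cp, qs⟩) rfl
  set m1 := execOps W m0 (Q0 qa ql aa) with hm1
  have B1 : BPre W g m1 := hB.of_frame fun c hc => f1 c (by omega) (by omega) (by omega) (by omega)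
  -- phase 1 (1 step)
  obtain ⟨s31, f2⟩ := execOps_Q1 (W := W) m1 (by rw [r15]; omega)
  have r2 := run_ops (P := P) (w := W) (O := O') (ρ := ρ') Q1 hc1 (c := ⟨some (pos + 36), m1, cp, qs⟩) rfl
  set m2 := execOps W m1 Q1 with hm2
  have T2 : MemLE VT m2 := fun c => by
    rcases eq_or_ne c 31 with rfl | hc
    · rw [s31, r15]; omega
    · rw [f2 c hc]; exact M1.1.memT c
  have M2 : MSide W ws VT dmem m2 := M1.of_frame hW T2 fun c hc => f2 c (by omega)
  have B2 : BPre W g m2 := B1.of_frame fun c hc => f2 c (by omega)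
  -- the width routine
  have hseg2 : readSeg m2 (40 + a) L = q := readSeg_M_eq M2 (by omega)
  obtain ⟨n3, hn3, m3, r3, s30, -, f3, T3'⟩ := run_widthCode (P := P) (W := W) (O := O') (ρ := ρ')
    (i₀ := pos + 37) (kk := kB) hc2 (c := ⟨some (pos + 37), m2, cp, qs⟩) rfl
    (fun c => by have := T2 c; simp only at this ⊢; omega) (p := 40 + a) (L := L)
    (by simp only; rw [f2 _ (by decide), r16]) (by simp only; rw [s31, r15]) (by omega) (by omega)
    (by simp only; rw [hseg2, hwsB]; exact hwsBW)
  simp only [] at r3 s30 f3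
  rw [hseg2, hwsB] at s30
  have T3 : MemLE VT m3 := fun c => by have := T3' c; omega
  have M3 : MSide W ws VT dmem m3 := M2.of_frame hW T3 fun c hc => f3 c (by omega)
  have B3 : BPre W g m3 := B2.of_frame fun c hc => f3 c (by omega)
  -- phase 2 (7 steps)
  have h10₃ : m3 10 = g := by
    rw [f3 _ (by omega), f2 _ (by decide), f1 _ (by decide) (by decide) (by decide) (by decide), h10]
  have h16₃ : m3 16 = L := by rw [f3 _ (by omega), f2 _ (by decide), r16]
  obtain ⟨M4, B4, s10, s11, f4⟩ := execOps_Q2 hW hVT M3 B3 le_rfl h10₃ s30 h16₃ hwsBW hgT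
  have r4 := run_ops (P := P) (w := W) (O := O') (ρ := ρ') Q2 hc3 (c := ⟨some (pos + 78), m3, cp, qs⟩) rfl
  set m4 := execOps W m3 Q2 with hm4
  rw [← dmB_zero dmem wsB L a] at B4
  -- phase 3 (3 steps)
  have h15₄ : m4 15 = a := by
    rw [f4 _ (by omega) (by omega) (by omega) (by omega) (by omega), f3 _ (by omega), f2 _ (by decide), r15]
  obtain ⟨s19, s20, s32, f5⟩ := execOps_Q3 (W := W) m4 (by rw [h15₄]; omega)
  have r5 := run_ops (P := P) (w := W) (O := O') (ρ := ρ') Q3 hc4 (c := ⟨some (pos + 85), m4, cp, qs⟩) rfl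
  set m5 := execOps W m4 Q3 with hm5
  have T5 : MemLE VT m5 := fun c => by
    by_cases c19 : c = 19; · rw [c19, s19, h15₄]; omega
    by_cases c20 : c = 20; · rw [c20, s20, f4 _ (by omega) (by omega) (by omega) (by omega) (by omega), h16₃]; omega
    by_cases c32 : c = 32; · rw [c32, s32]; omega
    rw [f5 c c19 c20 c32]; exact M4.1.memT c
  have M5 : MSide W ws VT dmem m5 := M4.of_frame hW T5 fun c hc => f5 c (by omega) (by omega) (by omega)
  have B5 : BSide W (g + 1) wsB VT (dmB dmem wsB L a 0) m5 :=
    B4.of_frame hW T5 fun c hc => f5 c (by omega) (by omega) (by omega)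
  -- copy-in loop (`L` rounds)
  have hcin := iterate_cinBody hVT hwsBW.le M5 B5 (by rw [s19, h15₄])
    (by rw [s20, f4 _ (by omega) (by omega) (by omega) (by omega) (by omega), h16₃]) s32 (by omega)
  have r6 := run_while (P := P) (w := W) (O := O') (ρ := ρ') hc5 L (c := ⟨some (pos + 88), m5, cp, qs⟩) rfl
    (fun j hj => by
      show ((fun m => execOps W m cinBody)^[j] m5) 20 ≠ 0
      rw [(hcin j hj.le).2.2.2.1]; omega)
    (by show ((fun m => execOps W m cinBody)^[L] m5) 20 = 0; rw [(hcin L le_rfl).2.2.2.1]; omega)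
  simp only [] at r6
  obtain ⟨M6, B6, -, -, -, f6⟩ := hcin L le_rfl
  set m6 := (fun m => execOps W m cinBody)^[L] m5 with hm6
  have B6' : BSide W (g + 1) wsB VT (init wsB q).mem m6 :=
    ⟨B6.1, Agree.congr_right B6.2 fun b => dmB_eq_init b⟩
  -- the run of `M_B`
  have hOKB := envOK_B (g := g + 1) hW hwsBW.le
  obtain ⟨nB, hnB, hrunMB, hstepB⟩ := hrunB.exists_run
  have hhaltB : cB.pc = none := (step_eq_none_iff _ _ _ _ _).1 hstepB
  have hrel : ERel LB (EB W (g + 1) wsB) VT MB (pos + 99) 0 (init wsB q) ⟨some (pos + 99), m6, cp, qs⟩ :=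
    ⟨by simp [bstart_zero], B6'.2, B6'.1⟩
  obtain ⟨n7, hn7, e7, r7, pc7, ag7, I7, co7, qu7, f7⟩ := emu_halt (L := LB) (E := EB W (g + 1) wsB)
    (VT := VT) (M := MB) (base := pos + 99) (qlen := 0) (qb := qb0) (P := P) hOKB hVT (by omega)
    (LB_regs_le (by omega)) (fun _ _ _ _ => rfl) hc6 hBdet hBof (V := VB) hMB (by simpa using hVBQ) hVBT
    (by simpa using hwsBV) hVB1 O' ρ' hrel (init_memLE _ _ (by simpa using hwsBV)) hrunMB hhaltB
  obtain ⟨pc7', m7, cp7, qs7⟩ := e7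
  simp only at pc7 ag7 I7 co7 qu7 f7 r7
  subst pc7' cp7 qs7
  rw [exitPos_B] at r7
  have M7 : MSide W ws VT dmem m7 := M6.of_frame hW I7.memT fun c hc => f7 c fun hf => by
    have := foot_B hf; omega
  have B7 : BSide W (g + 1) wsB VT cB.mem m7 := ⟨I7, ag7⟩
  -- the answer
  have hlo : cB.mem 0 = oq.length := by rw [← houtB, readOut_length]
  have hout : ∀ i, i < oq.length → cB.mem (1 + i) = oq[i]! := by
    intro i hi
    have h1 : (readOut cB.mem)[i]! = oq[i]! := by rw [houtB]
    rw [← h1, getElem!_pos (readOut cB.mem) i (by rw [readOut_length, hlo]; exact hi)]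
    simp [readOut, readSeg, List.getElem_map, List.getElem_range]
  -- phase 5 (13 steps)
  have h17₇ : m7 17 = ad := by
    rw [f7 17 (fun hf => by have := foot_B hf; omega), f6 _ (by omega) (by omega) (by omega) (by omega)
      (by omega) (by omega), f5 _ (by omega) (by omega) (by omega),
      f4 _ (by omega) (by omega) (by omega) (by omega) (by omega), f3 _ (by omega), f2 _ (by decide), r17]
  obtain ⟨M8, B8, s34, s33, s32', s20', f8⟩ := execOps_Q5 hws.le hVT hwsBW.le M7 B7 h17₇ (by omega)
    (by rw [hlo]; omega)
  have r8 := run_ops (P := P) (w := W) (O := O') (ρ := ρ') Q5 hc7 (c := ⟨some (pos + 99 + ℓB MB), m7, cp, qs⟩)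
    (by simp only [Nat.add_assoc])
  set m8 := execOps W m7 Q5 with hm8
  rw [hlo] at M8 s20'
  -- copy-out loop (`|oq|` rounds)
  have hcout := iterate_coutBody hws.le hVT hwsBW.le M8 B8 hout s32' s33 s20' (by omega)
  rw [show pos + (112 + ℓB MB) = pos + (99 + (ℓB MB + 13)) by omega] at hc8
  have r9 := run_while (P := P) (w := W) (O := O') (ρ := ρ') hc8 oq.length
    (c := ⟨some (pos + (99 + (ℓB MB + 13))), m8, cp, qs⟩) rfl
    (fun j hj => by
      show ((fun m => execOps W m coutBody)^[j] m8) 20 ≠ 0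
      rw [(hcout j hj.le).2.2.2.2.1]; omega)
    (by show ((fun m => execOps W m coutBody)^[oq.length] m8) 20 = 0; rw [(hcout _ le_rfl).2.2.2.2.1]; omega)
  simp only [] at r9
  obtain ⟨M9, B9, -, -, -, f9⟩ := hcout _ le_rfl
  set m9 := (fun m => execOps W m coutBody)^[oq.length] m8 with hm9
  rw [dmM_length] at M9
  -- assemble
  simp only [Q0_length, Q1_length, Q2_length, Q3_length, cinBody_length, Q5_length, coutBody_length,
    Nat.add_assoc, Nat.reduceAdd] at r1 r2 r3 r4 r5 r6 r7 r8 r9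
  refine ⟨36 + (1 + (n3 + (7 + (3 + ((L * 11 + 1) + (n7 + (13 + (oq.length * 16 + 1)))))))),
    ?_, ⟨some (pos + qlenM MB), m9, cp, qs⟩, ?_, rfl, ?_, ⟨wsB, B9⟩, ?_, rfl, rfl⟩
  · simp only [qbCost]
    simp only [widthCost] at hn3
    have : cstep = 38 := rfl
    rw [this] at hn7
    omega
  · have hrun := run_add_of_run _ _ _ _ r1 (run_add_of_run _ _ _ _ r2 (run_add_of_run _ _ _ _ r3
      (run_add_of_run _ _ _ _ r4 (run_add_of_run _ _ _ _ r5 (run_add_of_run _ _ _ _ r6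
      (run_add_of_run _ _ _ _ r7 (run_add_of_run _ _ _ _ r8 r9)))))))
    convert hrun using 4; simp only [qlenM]; omega
  · simpa only [List.length_map] using M9
  · show m9 10 = g + 1
    rw [f9 _ (by omega) (by omega) (by omega) (by omega) (by omega) (by omega),
      f8 _ (by omega) (by omega) (by omega) (by omega) (by omega) (by omega),
      f7 10 (fun hf => by have := foot_B hf; omega),
      f6 _ (by omega) (by omega) (by omega) (by omega) (by omega) (by omega),
      f5 _ (by omega) (by omega) (by omega), s10]

end whole

end Inline

end Literature.Computability.Cryptography.WordRAM
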